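import Literature.NumberTheory.EllipticCurves.Gamma0RankinSelbergResidue
import Literature.NumberTheory.EllipticCurves.NewformPeterssonSizeProofs
import HarnessLib

/-!
# `murty_petersson_newform_lower_bound` from a lower bound for the Rankin–Selberg residue

Topic `Literature/NumberTheory/EllipticCurves`; theorems only (no definition, no named fact). Last
brick of the `provefact` work on the named fact `murty_petersson_newform_lower_bound`
(`NewformPeterssonSize.lean`; Murty 1999, §2). The printed proof has two inputs:

* (RS) the Rankin–Selberg identity `(f, f) = c · [SL₂(ℤ):Γ₀(N)] · Res`, now PROVED in the tree as
  `tendsto_sub_one_mul_tsum_normSq_cuspCoeff` (`Gamma0RankinSelbergResidue.lean`):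
  `(s − 1)Σₙ|aₙ|²Γ(s+1)(4πn)^{-(s+1)} → 3 Re(f,f)/(π · gamma0Index N)` as `s → 1⁺`;
* (HL) the lower bound `Res ≫_ε N^{-ε}` for the newform of an elliptic curve of conductor `N` —
  Hoffstein–Lockhart 1994, Thm. 0.1 with the Goldfeld–Hoffstein–Lieman appendix
  (`L(1, sym² f) ≫ 1/log N` for non-CM `f`; for elliptic curves explicitly Watkins 2004,
  Lemma 3.4), the residue being `L(1, Sym² f)` times local factors of size `N^{o(1)}`
  (Watkins 2004, §1, §4). (HL) rests on the automorphy of `sym² f` on `GL(3)` and the analytic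
  theory of `GL(3) × GL(3)` Rankin–Selberg `L`-functions, none of which has a carrier in Mathlib
  or `Literature`; it is NOT vendored here as a named fact (D-0026).

This file proves that (HL), stated inline through the limit of (RS), implies the named fact
(`murty_petersson_newform_lower_bound_of_residue_lower_bound`): by (RS) and
`[SL₂(ℤ):Γ₀(N)] = gamma0Index N ≥ N` (`le_gamma0Index`), `Re(f,f) = π·gamma0Index N·Res/3 ≥
(πc/3) N^{1−ε}`. Together with `murty_petersson_newform_lower_bound_iff_log`
(`NewformPeterssonSizeProofs.lean`: the fact is exactly Murty's printed `(1−ε)log N < log(f,f)`)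
this pins the remaining content of the fact to (HL) alone.

## References

* [Murty1999CongruencePrimes] M. R. Murty, *Bounds for congruence primes* (1999), §2.
* [HoffsteinLockhart1994] J. Hoffstein, P. Lockhart, Ann. of Math. 140 (1994), Thm. 0.1 and the
  appendix by Goldfeld–Hoffstein–Lieman.
* [Watkins2004] M. Watkins, *Explicit lower bounds on the modular degree of an elliptic curve*,
  §1, Lemma 3.4, §4.
-/

noncomputable section

open scoped MatrixGroups ModularForm Real Topology
open Filter CongruenceSubgroup

namespace Literature.NumberTheory.EllipticCurves.ModularForms

/-! ### The reduction -/

section Reduction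

/-- `N ≤ gamma0Index N = [SL₂(ℤ):Γ₀(N)] = ∏_{p^e ∥ N} p^{e−1}(p+1)` (`N ≥ 1`; termwise
`pᵉ ≤ p^{e−1}(p+1)`). [folklore] -/
theorem le_gamma0Index {N : ℕ} (hN : N ≠ 0) : N ≤ gamma0Index N := by
  conv_lhs => rw [← Nat.prod_factorization_pow_eq_self hN]
  unfold gamma0Index Finsupp.prod
  refine Finset.prod_le_prod (fun p _ ↦ Nat.zero_le _) fun p hp ↦ ?_
  have hk : 0 < N.factorization p := Nat.pos_of_ne_zero (Finsupp.mem_support_iff.mp hp)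
  obtain ⟨j, hj⟩ : ∃ j, N.factorization p = j + 1 := ⟨N.factorization p - 1, by omega⟩
  rw [hj]
  show p ^ (j + 1) ≤ p ^ (j + 1 - 1) * (p + 1)
  rw [Nat.add_sub_cancel, pow_succ]
  exact Nat.mul_le_mul_left _ (Nat.le_succ p)

/-- **The Petersson norm from the Rankin–Selberg residue**: if
`(s − 1)Σₙ|aₙ|²Γ(s+1)(4πn)^{-(s+1)} → L` as `s → 1⁺` then `Re(f, f) = π · gamma0Index N · L/3`
(uniqueness of limits with `tendsto_sub_one_mul_tsum_normSq_cuspCoeff`; Murty 1999, §2: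
`(f,f) = c·[SL₂(ℤ):Γ₀(N)]·L(1, sym² f)·(local factors)`). [cite: Murty1999CongruencePrimes, §2 (proof of Thm. 1)] -/
theorem peterssonProduct_re_eq_of_tendsto {N : ℕ} [NeZero N] (f : CuspForm (Gamma0 N) 2) {L : ℝ}
    (hL : Tendsto (fun s : ℝ ↦ (s - 1) * ∑' n : ℕ, ‖cuspCoeff f n‖ ^ 2 *
        ((1 / (4 * π * n)) ^ (s + 1) * Real.Gamma (s + 1))) (𝓝[>] 1) (𝓝 L)) :
    (peterssonProduct (Gamma0 N) 2 f f).re = π * gamma0Index N * L / 3 := by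
  have h := tendsto_nhds_unique (tendsto_sub_one_mul_tsum_normSq_cuspCoeff f) hL
  have hπ : (π : ℝ) ≠ 0 := Real.pi_ne_zero
  have hg : (gamma0Index N : ℝ) ≠ 0 := by exact_mod_cast (gamma0Index_pos N).ne'
  rw [div_eq_iff (mul_ne_zero hπ hg)] at h
  linear_combination h / 3

/-- **`murty_petersson_newform_lower_bound` from the Hoffstein–Lockhart input.** If for every
`ε > 0` there is `c > 0` such that for every level `N ≥ 1`, every elliptic `W/ℚ` and every
`f ∈ S₂(Γ₀(N))` with `IsNewformOf W f` the Rankin–Selberg residue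
`L = lim_{s→1⁺}(s − 1)Σₙ|aₙ|²Γ(s+1)(4πn)^{-(s+1)}` (which exists,
`tendsto_sub_one_mul_tsum_normSq_cuspCoeff`) satisfies `c N^{-ε} ≤ L` — Hoffstein–Lockhart 1994,
Thm. 0.1 + appendix, in the form `L(1, sym² f)·(local factors) ≫_ε N^{-ε}` (Murty 1999, §2: "By a
result of Hoffstein and Lockhart [HL], we have `log (f, f) > (1 − ε) log N`"; Watkins 2004, §1 and
Lemma 3.4 for elliptic curves) — then the named fact holds, with constant `πc/3`:
`Re(f,f) = π·gamma0Index N·L/3 ≥ (π/3)·N·c N^{-ε}` (`le_gamma0Index`). The hypothesis is stated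
inline (no named fact is introduced); it is exactly the remaining, deep, input of the printed proof.
[cite: Murty1999CongruencePrimes, §2 (proof of Thm. 1); input HoffsteinLockhart1994 Thm. 0.1] -/
theorem murty_petersson_newform_lower_bound_of_residue_lower_bound
    (h : ∀ ε : ℝ, 0 < ε → ∃ c : ℝ, 0 < c ∧
      ∀ (N : ℕ) [NeZero N] (W : WeierstrassCurve ℚ) [W.IsElliptic] (f : CuspForm (Gamma0 N) 2),
        IsNewformOf W f → ∀ L : ℝ,
          Tendsto (fun s : ℝ ↦ (s - 1) * ∑' n : ℕ, ‖cuspCoeff f n‖ ^ 2 *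
            ((1 / (4 * π * n)) ^ (s + 1) * Real.Gamma (s + 1))) (𝓝[>] 1) (𝓝 L) →
          c * (N : ℝ) ^ (-ε) ≤ L) :
    murty_petersson_newform_lower_bound := by
  intro ε hε
  obtain ⟨c, hc, hcN⟩ := h ε hε
  refine ⟨π * c / 3, by positivity, fun N _ W _ f hf ↦ ?_⟩
  set L : ℝ := 3 * (peterssonProduct (Gamma0 N) 2 f f).re / (π * gamma0Index N) with hLdef
  have hL := tendsto_sub_one_mul_tsum_normSq_cuspCoeff f
  have hcL : c * (N : ℝ) ^ (-ε) ≤ L := hcN N W f hf L hL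
  have hre : (peterssonProduct (Gamma0 N) 2 f f).re = π * gamma0Index N * L / 3 :=
    peterssonProduct_re_eq_of_tendsto f hL
  have hNpos : (0 : ℝ) < N := by exact_mod_cast NeZero.pos N
  have hg : (N : ℝ) ≤ gamma0Index N := by exact_mod_cast le_gamma0Index (NeZero.ne N)
  have hπ := Real.pi_pos
  rw [hre]
  calc π * c / 3 * (N : ℝ) ^ (1 - ε) = π * N * (c * (N : ℝ) ^ (-ε)) / 3 := by
        rw [show (1 : ℝ) - ε = 1 + -ε by ring, Real.rpow_add hNpos, Real.rpow_one]; ring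
    _ ≤ π * N * L / 3 := by gcongr
    _ ≤ π * gamma0Index N * L / 3 := by
        have hL0 : 0 ≤ L := le_trans (by positivity) hcL
        gcongr

/-- **Classical form of the residue identity**: `(w − 2) Σₙ |aₙ|² n^{-w} → 48π Re(f,f)/[SL₂(ℤ):Γ₀(N)]`
as `w → 2⁺` (`w = s + 1`; `Γ(2) = 1`, `(4π)² = 16π²`), i.e. `Res_{w=2} Σ|aₙ|²n^{-w} = 48π(f,f)/ν(N)`
for `f ∈ S₂(Γ₀(N))` (Rankin 1939; the normalisation used by Murty 1999, §2 and Watkins 2004, §1).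
[cite: Murty1999CongruencePrimes, §2 (proof of Thm. 1)] -/
theorem tendsto_sub_two_mul_tsum_normSq_cuspCoeff_div_rpow {N : ℕ} [NeZero N] (f : CuspForm (Gamma0 N) 2) :
    Tendsto (fun w : ℝ ↦ (w - 2) * ∑' n : ℕ, ‖cuspCoeff f n‖ ^ 2 / (n : ℝ) ^ w) (𝓝[>] 2)
      (𝓝 (48 * π * (peterssonProduct (Gamma0 N) 2 f f).re / gamma0Index N)) := by
  have hT := tendsto_sub_one_mul_tsum_normSq_cuspCoeff f
  -- substitute `s = w - 1`
  have hmap : Tendsto (fun w : ℝ ↦ w - 1) (𝓝[>] 2) (𝓝[>] 1) := by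
    have h := ((continuous_sub_right (1 : ℝ)).continuousWithinAt (s := Set.Ioi (2 : ℝ)) (x := 2)).tendsto_nhdsWithin
      (t := Set.Ioi (1 : ℝ)) (fun w hw ↦ by simp only [Set.mem_Ioi] at hw ⊢; linarith)
    rw [show (2 : ℝ) - 1 = 1 by norm_num] at h
    exact h
  have h1 := hT.comp hmap
  -- the factor `(4π)^w / Γ(w) → 16π²`
  have hfac : Tendsto (fun w : ℝ ↦ (4 * π) ^ w / Real.Gamma w) (𝓝[>] 2) (𝓝 (16 * π ^ 2)) := by
    have hc : ContinuousAt (fun w : ℝ ↦ (4 * π) ^ w / Real.Gamma w) 2 := by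
      refine ContinuousAt.div ?_ ?_ (by rw [Real.Gamma_two]; norm_num)
      · exact (Real.continuousAt_const_rpow (by positivity)).comp continuousAt_id
      · exact (Real.differentiableAt_Gamma fun m ↦ by
          have : (0 : ℝ) ≤ m := Nat.cast_nonneg m
          linarith).continuousAt
    have hv : (4 * π) ^ (2 : ℝ) / Real.Gamma 2 = 16 * π ^ 2 := by
      rw [Real.Gamma_two, div_one, Real.rpow_two]; ring
    rw [← hv]
    exact hc.tendsto.mono_left nhdsWithin_le_nhds
  have h2 := h1.mul hfac
  have hval : 3 * (peterssonProduct (Gamma0 N) 2 f f).re / (π * gamma0Index N) * (16 * π ^ 2) =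
      48 * π * (peterssonProduct (Gamma0 N) 2 f f).re / gamma0Index N := by
    have hπ : (π : ℝ) ≠ 0 := Real.pi_ne_zero
    field_simp
    ring
  rw [hval] at h2
  refine h2.congr' ?_
  filter_upwards [self_mem_nhdsWithin] with w hw
  simp only [Set.mem_Ioi] at hw
  have hw0 : 0 < w := by linarith
  simp only [Function.comp_apply]
  rw [show w - 1 - 1 = w - 2 by ring, show w - 1 + 1 = w by ring]
  -- termwise: `|aₙ|² (1/(4πn))^w Γ(w) · ((4π)^w/Γ(w)) = |aₙ|²/n^w`
  have hΓ : Real.Gamma w ≠ 0 := (Real.Gamma_pos_of_pos hw0).ne'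
  have h4π : (0 : ℝ) < 4 * π := by positivity
  rw [mul_assoc, ← tsum_mul_right]
  congr 1
  refine tsum_congr fun n ↦ ?_
  rcases Nat.eq_zero_or_pos n with rfl | hn
  · simp [Real.zero_rpow hw0.ne']
  · have hn' : (0 : ℝ) < n := by exact_mod_cast hn
    rw [one_div, Real.inv_rpow (by positivity), Real.mul_rpow h4π.le hn'.le]
    field_simp

/-- The parametrisation-data form of the fact (the inequality for `D.f`,
`D : ModularParametrizationData W N`; formerly vendored separately as the duplicate named fact
`HoffsteinLockhart1994_peterssonProduct_lower_bound`, since merged into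
`murty_petersson_newform_lower_bound`) from the same Hoffstein–Lockhart input, through
`murty_petersson_newform_lower_bound_of_residue_lower_bound` and the bridge
`HoffsteinLockhart1994_peterssonProduct_lower_bound_of_murty`. [cite: Murty1999CongruencePrimes, §2 (proof of Thm. 1)] -/
theorem HoffsteinLockhart1994_peterssonProduct_lower_bound_of_residue_lower_bound
    (h : ∀ ε : ℝ, 0 < ε → ∃ c : ℝ, 0 < c ∧
      ∀ (N : ℕ) [NeZero N] (W : WeierstrassCurve ℚ) [W.IsElliptic] (f : CuspForm (Gamma0 N) 2),
        IsNewformOf W f → ∀ L : ℝ,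
          Tendsto (fun s : ℝ ↦ (s - 1) * ∑' n : ℕ, ‖cuspCoeff f n‖ ^ 2 *
            ((1 / (4 * π * n)) ^ (s + 1) * Real.Gamma (s + 1))) (𝓝[>] 1) (𝓝 L) →
          c * (N : ℝ) ^ (-ε) ≤ L) :
    ∀ ε : ℝ, 0 < ε → ∃ c : ℝ, 0 < c ∧ ∀ (N : ℕ) [NeZero N] (W : WeierstrassCurve ℚ) [W.IsElliptic]
      (D : ModularParametrizationData W N),
      c * (N : ℝ) ^ (1 - ε) ≤ (peterssonProduct (Gamma0 N) 2 D.f D.f).re :=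
  HoffsteinLockhart1994_peterssonProduct_lower_bound_of_murty
    (murty_petersson_newform_lower_bound_of_residue_lower_bound h)

end Reduction

end Literature.NumberTheory.EllipticCurves.ModularForms

end
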